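import Summits.QuantumFields.YangMills.Theorems.UnitScaleTiltProp7KinvVariationalRows
import Summits.QuantumFields.YangMills.Theorems.UnitScaleTiltProp7RieszTauFrobNormT3
import HarnessLib

/-!
# Route `UnitScaleTilt`, crux K1 «MinimiserStabilityRegPr» (stmt-QuantumFields-19200), EX rows `h137kπ` ∕ `h137kΔ` ∕ `hCk` — **K-STOREY BRICK (K2a) (px12 g16, LOCATE-K137 529f36ee road
# (K2)): THE COARSE AGMON STEP FOR `K⁻¹ = (Q_kGQ_k*)⁻¹`, OPERATOR LEVEL** — (i) if the CONJUGATED operator `M K M⁻¹` is accretive on the range of the weight `M`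
# (`m‖Mu‖² ≤ re⟪Mu, M(Ku)⟫`) then `‖M(K⁻¹v)‖ ≤ m⁻¹‖Mv‖`; (ii) the accretivity of `M K M⁻¹ = (MQM_f⁻¹)(M_fGM_f⁻¹)(M_fQ†M⁻¹)` follows from the coercivity `m₀` of `K` (✓p767189) and THREE
# conjugation letters `‖MQM_f⁻¹ − Q‖ ≤ δ₁`, `‖M_fQ†M⁻¹ − Q†‖ ≤ δ₂`, `‖M_fGM_f⁻¹ − G‖ ≤ δ₃` with `m = m₀ − (C_QB_Gδ₂ + C_Qδ₃(C_Q+δ₂) + δ₁(B_G+δ₃)(C_Q+δ₂))`; (iii) read at a coarse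
# bond-spike source with the multiplicative weight `w`: **`‖(toL2B⁻¹(K⁻¹(toL2B(δ_{y′}⊗Z))))(y)‖ ≤ √2·m⁻¹·(w y′∕w y)·‖Z‖`** — exponential ENTRY DECAY of `(Q_kGQ_k*)⁻¹` once `w = e^{φ}`,
# the shape the `h137k•` kernels want before composing with `Q_k†` (K3).

Cell `ym3-torus` (HUMAN RULING D-0037: SU(2) YM₃ on T³ is ladder rung R3 — NOT d = 4, NOT infinite volume, NOT a mass gap, NOT Clay).  Width seat `ym3-torus-px12` gen 16.  THEOREMS ONLY
(0 `def`, 0 `sorry`); `--supports stmt-QuantumFields-19200 --as helper`, count-neutral.  HONEST LABEL: abstract Hilbert-space algebra (the one-form twin of routeR-w2's ✓`re_conj_gram_ge` ∕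
✓`gram_inv_weighted_decay`, without matrices) + the pointwise reading on the coarse carrier; the three conjugation letters and `m₀` are HYPOTHESES (member rows: `Q_k` weight-conjugation =
px21's A2 lineage, one-form conjugated resolvent = A1–A3 lineage, `m₀` = (K1) ✓`norm_KinvT_le_of_interpolant_rows`); nothing of (3.132), `h137kπ`, `h137kΔ`, `hCk`, EX or 19200 is proved here.

WHAT IS PROVED (ns `Summit.QuantumFields.YangMills.Theorems.Prop7KinvConjugateDecay`).
* §1 (abstract) ★★ `norm_weight_inv_le_of_conj_accretive`; `neg_mul_le_re_inner`; ★★ `re_inner_triple_ge_of_letters` (the perturbation algebra `(Q+d₁)(G+d₃)(Q†+d₂)`);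
  ★★★ `conj_accretive_of_letters` (`(m₀ − R)‖Mu‖² ≤ re⟪Mu, M(QGQ†u)⟫` from `M⁻¹M = 1`, `M_f⁻¹M_f = 1` and the three letters).
* §2 (member, coarse carrier `toL2B F n cB`, weight `w > 0` as a hypothesis-described multiplication operator `M`) `equiv_weight_apply`, `norm_toL2B_single`, ★ `norm_weight_toL2B_single`,
  ★ `norm_symm_apply_le_of_weight`, ★★★ `norm_symm_Kinv_single_le_of_conj_accretive` (the entry-decay reading above).

References: T. Bałaban, CMP **99** (1985) 389–434 [Balaban1985BackgroundPropagators] ((3.132) p.422, (3.46) p.398, (3.126) p.420); S. Agmon, *Lectures on exponential decay of solutions of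
second-order elliptic equations* (Princeton 1982) Ch. 1 [folklore]; J.-M. Combes, L. Thomas, CMP **34** (1973) 251–270 [folklore].
-/

set_option autoImplicit false

noncomputable section

open scoped BigOperators InnerProductSpace ComplexConjugate Matrix.Norms.L2Operator

namespace Summit.QuantumFields.YangMills.Theorems.Prop7KinvConjugateDecay

open Literature.MathematicalPhysics.QuantumFieldTheory.Balaban1983to89
open Literature.MathematicalPhysics.QuantumFieldTheory.Balaban1983to89.T3ContinuumYM3Torus
open B9Eq311L2Pairing (WL2)
open Summit.QuantumFields.YangMills.Theorems.Prop7SectET3HilbertLetters (W₂ frobEquiv toL2B toL2B_apply toL2B_symm_apply)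
open Summit.QuantumFields.YangMills.Theorems.Prop7RieszTauFrobNorm (norm_sq_frobEquiv_symm norm_le_norm_frobEquiv_symm norm_frobEquiv_symm_le)

/-! ## §1 Abstract: weighted inverse bound from conjugated accretivity; accretivity of the conjugated `QGQ†` from three letters -/

section Abstract

variable {V C : Type*} [NormedAddCommGroup V] [InnerProductSpace ℂ V] [NormedAddCommGroup C] [InnerProductSpace ℂ C]

/-- ★★ **AGMON AT THE OPERATOR LEVEL**: if `KK⁻¹ = 1` and the conjugated operator is accretive on the range of the weight, `m‖Mu‖² ≤ re⟪Mu, M(Ku)⟫` for all `u` (`0 < m`), then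
`‖M(K⁻¹v)‖ ≤ m⁻¹‖Mv‖` for all `v` (test `u := K⁻¹v`, Cauchy–Schwarz). [folklore] [cite: Balaban1985BackgroundPropagators, Thm 3.1 (3.46) p.398, (3.132) p.422] -/
theorem norm_weight_inv_le_of_conj_accretive (Kop Kinv : C →ₗ[ℂ] C) (hKK : ∀ v, Kop (Kinv v) = v) (M : C →ₗ[ℂ] C)
    {m : ℝ} (hm : 0 < m) (hacc : ∀ u, m * ‖M u‖ ^ 2 ≤ RCLike.re ⟪M u, M (Kop u)⟫_ℂ) (v : C) :
    ‖M (Kinv v)‖ ≤ m⁻¹ * ‖M v‖ := by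
  have h1 := hacc (Kinv v)
  rw [hKK] at h1
  have h2 : m * ‖M (Kinv v)‖ ^ 2 ≤ ‖M (Kinv v)‖ * ‖M v‖ := h1.trans ((RCLike.re_le_norm _).trans (norm_inner_le_norm _ _))
  by_cases h0 : ‖M (Kinv v)‖ = 0
  · rw [h0]; positivity
  · have hpos : 0 < ‖M (Kinv v)‖ := lt_of_le_of_ne (norm_nonneg _) (Ne.symm h0)
    have h3 : m * ‖M (Kinv v)‖ ≤ ‖M v‖ := by
      have h4 : (m * ‖M (Kinv v)‖) * ‖M (Kinv v)‖ ≤ ‖M v‖ * ‖M (Kinv v)‖ := by nlinarith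
      exact le_of_mul_le_mul_right h4 hpos
    calc ‖M (Kinv v)‖ = m⁻¹ * (m * ‖M (Kinv v)‖) := by field_simp
      _ ≤ m⁻¹ * ‖M v‖ := mul_le_mul_of_nonneg_left h3 (inv_pos.mpr hm).le

/-- `−‖x‖‖y‖ ≤ re⟪x, y⟫`. [folklore] -/
theorem neg_mul_le_re_inner (x y : C) : -(‖x‖ * ‖y‖) ≤ RCLike.re ⟪x, y⟫_ℂ :=
  (abs_le.mp ((RCLike.abs_re_le_norm _).trans (norm_inner_le_norm x y))).1

/-- ★★ **THE PERTURBATION ALGEBRA `(Q + d₁)(G + d₃)(Q† + d₂)`**: if `m₀‖c‖² ≤ re⟪c, QGQ†c⟫`, `‖Q†c‖ ≤ C_Q‖c‖`, `‖Gx‖ ≤ B_G‖x‖`, and `A`, `B`, `C′` are `δ₁`-, `δ₃`-, `δ₂`-close to `Q`, `G`, `Q†`,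
then `(m₀ − (C_QB_Gδ₂ + C_Qδ₃(C_Q+δ₂) + δ₁(B_G+δ₃)(C_Q+δ₂)))‖c‖² ≤ re⟪c, A(B(C′c))⟫`. [folklore] [cite: Balaban1985BackgroundPropagators, (3.46) p.398, (3.132) p.422] -/
theorem re_inner_triple_ge_of_letters (Q : V →ₗ[ℂ] C) (Qadj : C →ₗ[ℂ] V) (hadj : ∀ (x : V) (c : C), ⟪Q x, c⟫_ℂ = ⟪x, Qadj c⟫_ℂ) (G : V →ₗ[ℂ] V)
    (A : V →ₗ[ℂ] C) (B : V →ₗ[ℂ] V) (C' : C →ₗ[ℂ] V) {m₀ CQ BG δ₁ δ₂ δ₃ : ℝ} (hCQ : 0 ≤ CQ) (hBG : 0 ≤ BG) (hδ₁ : 0 ≤ δ₁) (hδ₃ : 0 ≤ δ₃)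
    (hco : ∀ c, m₀ * ‖c‖ ^ 2 ≤ RCLike.re ⟪c, Q (G (Qadj c))⟫_ℂ)
    (hQadj : ∀ c, ‖Qadj c‖ ≤ CQ * ‖c‖) (hG : ∀ x, ‖G x‖ ≤ BG * ‖x‖)
    (hA : ∀ x, ‖A x - Q x‖ ≤ δ₁ * ‖x‖) (hB : ∀ x, ‖B x - G x‖ ≤ δ₃ * ‖x‖) (hC : ∀ c, ‖C' c - Qadj c‖ ≤ δ₂ * ‖c‖) (c : C) :
    (m₀ - (CQ * BG * δ₂ + CQ * δ₃ * (CQ + δ₂) + δ₁ * (BG + δ₃) * (CQ + δ₂))) * ‖c‖ ^ 2 ≤ RCLike.re ⟪c, A (B (C' c))⟫_ℂ := by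
  -- the three defects along the chain
  set e₂ : V := C' c - Qadj c with he₂
  set e₃ : V := B (C' c) - G (C' c) with he₃
  set e₁ : C := A (B (C' c)) - Q (B (C' c)) with he₁
  have hy : ‖C' c‖ ≤ (CQ + δ₂) * ‖c‖ := by
    calc ‖C' c‖ = ‖Qadj c + e₂‖ := by rw [he₂, add_sub_cancel]
      _ ≤ ‖Qadj c‖ + ‖e₂‖ := norm_add_le _ _
      _ ≤ CQ * ‖c‖ + δ₂ * ‖c‖ := add_le_add (hQadj c) (hC c)
      _ = (CQ + δ₂) * ‖c‖ := by ring
  have hz : ‖B (C' c)‖ ≤ (BG + δ₃) * ((CQ + δ₂) * ‖c‖) := by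
    calc ‖B (C' c)‖ = ‖G (C' c) + e₃‖ := by rw [he₃, add_sub_cancel]
      _ ≤ ‖G (C' c)‖ + ‖e₃‖ := norm_add_le _ _
      _ ≤ BG * ‖C' c‖ + δ₃ * ‖C' c‖ := add_le_add (hG _) (hB _)
      _ = (BG + δ₃) * ‖C' c‖ := by ring
      _ ≤ (BG + δ₃) * ((CQ + δ₂) * ‖c‖) := mul_le_mul_of_nonneg_left hy (by positivity)
  have he₂n : ‖e₂‖ ≤ δ₂ * ‖c‖ := hC c
  have he₃n : ‖e₃‖ ≤ δ₃ * ((CQ + δ₂) * ‖c‖) := (hB _).trans (mul_le_mul_of_nonneg_left hy hδ₃)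
  have he₁n : ‖e₁‖ ≤ δ₁ * ((BG + δ₃) * ((CQ + δ₂) * ‖c‖)) := (hA _).trans (mul_le_mul_of_nonneg_left hz hδ₁)
  -- expansion `A(B(C′c)) = Q(G(Q†c)) + Q(G e₂) + Q e₃ + e₁`
  have hexp : A (B (C' c)) = Q (G (Qadj c)) + Q (G e₂) + Q e₃ + e₁ := by
    have h1 : C' c = Qadj c + e₂ := by rw [he₂, add_sub_cancel]
    have h2 : B (C' c) = G (C' c) + e₃ := by rw [he₃, add_sub_cancel]
    have h3 : A (B (C' c)) = Q (B (C' c)) + e₁ := by rw [he₁, add_sub_cancel]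
    rw [h3, h2, map_add, h1, map_add, map_add]
  -- the three cross terms through `⟪c, Qw⟫ = ⟪Q†… ⟫`: `re⟪c, Qw⟫ ≥ −‖Q†c‖‖w‖`
  have hQre : ∀ w : V, -(CQ * ‖c‖ * ‖w‖) ≤ RCLike.re ⟪c, Q w⟫_ℂ := fun w => by
    have e : RCLike.re ⟪c, Q w⟫_ℂ = RCLike.re ⟪Qadj c, w⟫_ℂ := by
      rw [inner_re_symm, hadj, inner_re_symm]
    rw [e]
    have h := neg_mul_le_re_inner (Qadj c) w
    have h' : ‖Qadj c‖ * ‖w‖ ≤ CQ * ‖c‖ * ‖w‖ := mul_le_mul_of_nonneg_right (hQadj c) (norm_nonneg _)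
    linarith
  have hb₂ := hQre (G e₂)
  have hb₃ := hQre e₃
  have hb₁ := neg_mul_le_re_inner c e₁
  have hGe₂ : ‖G e₂‖ ≤ BG * (δ₂ * ‖c‖) := (hG e₂).trans (mul_le_mul_of_nonneg_left he₂n hBG)
  rw [hexp, inner_add_right, inner_add_right, inner_add_right, map_add, map_add, map_add]
  have hc0 : 0 ≤ ‖c‖ := norm_nonneg _
  have t₂ : -(CQ * BG * δ₂ * ‖c‖ ^ 2) ≤ RCLike.re ⟪c, Q (G e₂)⟫_ℂ := by
    have : CQ * ‖c‖ * ‖G e₂‖ ≤ CQ * ‖c‖ * (BG * (δ₂ * ‖c‖)) := mul_le_mul_of_nonneg_left hGe₂ (by positivity)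
    nlinarith
  have t₃ : -(CQ * δ₃ * (CQ + δ₂) * ‖c‖ ^ 2) ≤ RCLike.re ⟪c, Q e₃⟫_ℂ := by
    have : CQ * ‖c‖ * ‖e₃‖ ≤ CQ * ‖c‖ * (δ₃ * ((CQ + δ₂) * ‖c‖)) := mul_le_mul_of_nonneg_left he₃n (by positivity)
    nlinarith
  have t₁ : -(δ₁ * (BG + δ₃) * (CQ + δ₂) * ‖c‖ ^ 2) ≤ RCLike.re ⟪c, e₁⟫_ℂ := by
    have : ‖c‖ * ‖e₁‖ ≤ ‖c‖ * (δ₁ * ((BG + δ₃) * ((CQ + δ₂) * ‖c‖))) := mul_le_mul_of_nonneg_left he₁n hc0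
    nlinarith
  have t₀ := hco c
  nlinarith

/-- ★★★ **ACCRETIVITY OF THE CONJUGATED `QGQ†` FROM THREE CONJUGATION LETTERS**: with a coarse weight pair `M`, `Mi` (`Mi∘M = 1`) and a fine pair `M_f`, `M_fi` (`M_fi∘M_f = 1`),
`MKMi = (MQM_fi)(M_fGM_fi)(M_fQ†Mi)`, so the letters `‖MQM_fi − Q‖ ≤ δ₁`, `‖M_fQ†Mi − Q†‖ ≤ δ₂`, `‖M_fGM_fi − G‖ ≤ δ₃` and the coercivity `m₀` of `K = QGQ†` give
`(m₀ − R)‖Mu‖² ≤ re⟪Mu, M(K u)⟫`, `R = C_QB_Gδ₂ + C_Qδ₃(C_Q+δ₂) + δ₁(B_G+δ₃)(C_Q+δ₂)`. [folklore] [cite: Balaban1985BackgroundPropagators, Thm 3.1 (3.46) p.398, (3.132) p.422] -/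
theorem conj_accretive_of_letters (Q : V →ₗ[ℂ] C) (Qadj : C →ₗ[ℂ] V) (hadj : ∀ (x : V) (c : C), ⟪Q x, c⟫_ℂ = ⟪x, Qadj c⟫_ℂ) (G : V →ₗ[ℂ] V)
    (M Mi : C →ₗ[ℂ] C) (hMi : ∀ c, Mi (M c) = c) (Mf Mfi : V →ₗ[ℂ] V) (hMfi : ∀ x, Mfi (Mf x) = x)
    {m₀ CQ BG δ₁ δ₂ δ₃ : ℝ} (hCQ : 0 ≤ CQ) (hBG : 0 ≤ BG) (hδ₁ : 0 ≤ δ₁) (hδ₃ : 0 ≤ δ₃)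
    (hco : ∀ c, m₀ * ‖c‖ ^ 2 ≤ RCLike.re ⟪c, Q (G (Qadj c))⟫_ℂ)
    (hQadj : ∀ c, ‖Qadj c‖ ≤ CQ * ‖c‖) (hG : ∀ x, ‖G x‖ ≤ BG * ‖x‖)
    (hA : ∀ x, ‖M (Q (Mfi x)) - Q x‖ ≤ δ₁ * ‖x‖) (hB : ∀ x, ‖Mf (G (Mfi x)) - G x‖ ≤ δ₃ * ‖x‖) (hC : ∀ c, ‖Mf (Qadj (Mi c)) - Qadj c‖ ≤ δ₂ * ‖c‖) (u : C) :
    (m₀ - (CQ * BG * δ₂ + CQ * δ₃ * (CQ + δ₂) + δ₁ * (BG + δ₃) * (CQ + δ₂))) * ‖M u‖ ^ 2 ≤ RCLike.re ⟪M u, M (Q (G (Qadj u)))⟫_ℂ := by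
  have h := re_inner_triple_ge_of_letters Q Qadj hadj G (M ∘ₗ Q ∘ₗ Mfi) (Mf ∘ₗ G ∘ₗ Mfi) (Mf ∘ₗ Qadj ∘ₗ Mi) hCQ hBG hδ₁ hδ₃ hco hQadj hG
    (fun x => by simpa only [LinearMap.comp_apply] using hA x) (fun x => by simpa only [LinearMap.comp_apply] using hB x)
    (fun c => by simpa only [LinearMap.comp_apply] using hC c) (M u)
  have e : (M ∘ₗ Q ∘ₗ Mfi) ((Mf ∘ₗ G ∘ₗ Mfi) ((Mf ∘ₗ Qadj ∘ₗ Mi) (M u))) = M (Q (G (Qadj u))) := by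
    simp only [LinearMap.comp_apply, hMi, hMfi]
  rw [e] at h
  exact h

end Abstract

/-! ## §2 The pointwise reading on the coarse carrier: entry decay of `K⁻¹` from a coarse bond spike -/

section Member

variable {F : T3Family} {n : ℕ} {cB : ℝ} [Fact (0 < cB)]

omit [Fact (0 < cB)] in
/-- The coordinates of a weighted field: `equiv (toL2B (w•Z)) y = w y • equiv (toL2B Z) y`. [cite: Balaban1985BackgroundPropagators, (3.16) p.393] -/
theorem equiv_weight_apply (w : PBond (F.P n) 0 → ℝ) (Z : PBond (F.P n) 0 → Matrix (Fin 2) (Fin 2) ℂ) (y : PBond (F.P n) 0) :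
    WL2.equiv ℂ (fun _ : PBond (F.P n) 0 => cB) W₂ (toL2B F n cB (fun y' => w y' • Z y')) y = w y • WL2.equiv ℂ (fun _ : PBond (F.P n) 0 => cB) W₂ (toL2B F n cB Z) y := by
  rw [toL2B_apply, toL2B_apply, ← Complex.coe_smul, map_smul, Complex.coe_smul]

/-- **`‖toL2B (δ_{y′} ⊗ X)‖² = cB·‖X‖_F²`** (`‖·‖_F` = the `W₂` norm of `frobEquiv⁻¹X`). [cite: Balaban1985BackgroundPropagators, (3.16) p.393] -/
theorem norm_toL2B_single [DecidableEq (PBond (F.P n) 0)] (y' : PBond (F.P n) 0) (X : Matrix (Fin 2) (Fin 2) ℂ) :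
    ‖toL2B F n cB (Pi.single y' X)‖ ^ 2 = cB * ‖(frobEquiv.symm X : W₂)‖ ^ 2 := by
  rw [WL2.norm_sq, Finset.sum_eq_single y']
  · rw [toL2B_apply, Pi.single_eq_same]
  · intro c _ hc
    rw [toL2B_apply, Pi.single_eq_of_ne hc, map_zero, norm_zero]; ring
  · intro h; exact absurd (Finset.mem_univ _) h

/-- ★ **THE WEIGHTED NORM OF A SPIKE: `‖M(toL2B(δ_{y′}⊗X))‖ = |w y′|·‖toL2B(δ_{y′}⊗X)‖`** for a multiplication operator `M` by the real weight `w` (described by `hMw`).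
[cite: Balaban1985BackgroundPropagators, (3.16) p.393] -/
theorem norm_weight_toL2B_single [DecidableEq (PBond (F.P n) 0)] (w : PBond (F.P n) 0 → ℝ) (M : WL2 ℂ (fun _ : PBond (F.P n) 0 => cB) W₂ →ₗ[ℂ] WL2 ℂ (fun _ : PBond (F.P n) 0 => cB) W₂)
    (hMw : ∀ Z, M (toL2B F n cB Z) = toL2B F n cB (fun y => w y • Z y)) (y' : PBond (F.P n) 0) (X : Matrix (Fin 2) (Fin 2) ℂ) :
    ‖M (toL2B F n cB (Pi.single y' X))‖ = |w y'| * ‖toL2B F n cB (Pi.single y' X)‖ := by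
  have e : (fun y => w y • (Pi.single y' X : PBond (F.P n) 0 → Matrix (Fin 2) (Fin 2) ℂ) y) = Pi.single y' (w y' • X) := by
    funext y
    by_cases hy : y = y'
    · subst hy; rw [Pi.single_eq_same, Pi.single_eq_same]
    · rw [Pi.single_eq_of_ne hy, Pi.single_eq_of_ne hy, smul_zero]
  have h1 := norm_toL2B_single (cB := cB) (F := F) y' (w y' • X)
  have h2 := norm_toL2B_single (cB := cB) (F := F) y' X
  have h3 : ‖(frobEquiv.symm (w y' • X) : W₂)‖ = |w y'| * ‖(frobEquiv.symm X : W₂)‖ := by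
    rw [← Complex.coe_smul, map_smul, norm_smul, Complex.norm_real, Real.norm_eq_abs]
  have hcB : 0 < cB := Fact.out
  have hL : ‖M (toL2B F n cB (Pi.single y' X))‖ ^ 2 = cB * (|w y'| * ‖(frobEquiv.symm X : W₂)‖) ^ 2 := by rw [hMw, e, h1, h3]
  have hR : (|w y'| * ‖toL2B F n cB (Pi.single y' X)‖) ^ 2 = cB * (|w y'| * ‖(frobEquiv.symm X : W₂)‖) ^ 2 := by rw [mul_pow, h2]; ring
  exact (pow_left_inj₀ (norm_nonneg _) (by positivity) two_ne_zero).mp (hL.trans hR.symm)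

/-- ★ **A POINTWISE VALUE IS BELOW THE WEIGHTED NORM**: `‖(toL2B⁻¹ g)(y)‖ ≤ ‖Mg‖∕(√cB·w y)` for `0 < w y` (`‖·‖` on `M₂(ℂ)` the operator norm, `≤` the `W₂` norm; lit ✓`WL2.weight_mul_norm_sq_apply_le`).
[cite: Balaban1985BackgroundPropagators, (3.16) p.393] -/
theorem norm_symm_apply_le_of_weight (w : PBond (F.P n) 0 → ℝ) (M : WL2 ℂ (fun _ : PBond (F.P n) 0 => cB) W₂ →ₗ[ℂ] WL2 ℂ (fun _ : PBond (F.P n) 0 => cB) W₂)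
    (hMw : ∀ Z, M (toL2B F n cB Z) = toL2B F n cB (fun y => w y • Z y)) (g : WL2 ℂ (fun _ : PBond (F.P n) 0 => cB) W₂) (y : PBond (F.P n) 0) (hy : 0 < w y) :
    ‖(toL2B F n cB).symm g y‖ ≤ ‖M g‖ / (Real.sqrt cB * w y) := by
  have hcB : 0 < cB := Fact.out
  have hs : 0 < Real.sqrt cB := Real.sqrt_pos.2 hcB
  -- `equiv (Mg) y = w y • equiv g y`
  have e1 : WL2.equiv ℂ (fun _ : PBond (F.P n) 0 => cB) W₂ (M g) y = w y • WL2.equiv ℂ (fun _ : PBond (F.P n) 0 => cB) W₂ g y := by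
    have hg : toL2B F n cB ((toL2B F n cB).symm g) = g := LinearEquiv.apply_symm_apply _ _
    have h := equiv_weight_apply (cB := cB) w ((toL2B F n cB).symm g) y
    rw [← hMw, hg] at h
    exact h
  -- `cB‖equiv (Mg) y‖² ≤ ‖Mg‖²`
  have h1 := WL2.weight_mul_norm_sq_apply_le (𝕜 := ℂ) (w := fun _ : PBond (F.P n) 0 => cB) (V := W₂) (M g) y
  rw [e1, norm_smul, Real.norm_eq_abs, abs_of_pos hy] at h1
  -- `‖toL2B⁻¹ g y‖ ≤ ‖equiv g y‖`
  have h2 : ‖(toL2B F n cB).symm g y‖ ≤ ‖WL2.equiv ℂ (fun _ : PBond (F.P n) 0 => cB) W₂ g y‖ := by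
    rw [toL2B_symm_apply]
    have := norm_le_norm_frobEquiv_symm (frobEquiv (WL2.equiv ℂ (fun _ : PBond (F.P n) 0 => cB) W₂ g y))
    rwa [LinearEquiv.symm_apply_apply] at this
  rw [le_div_iff₀ (by positivity)]
  have h3 : (‖WL2.equiv ℂ (fun _ : PBond (F.P n) 0 => cB) W₂ g y‖ * (Real.sqrt cB * w y)) ^ 2 ≤ ‖M g‖ ^ 2 := by
    calc (‖WL2.equiv ℂ (fun _ : PBond (F.P n) 0 => cB) W₂ g y‖ * (Real.sqrt cB * w y)) ^ 2
        = cB * (w y * ‖WL2.equiv ℂ (fun _ : PBond (F.P n) 0 => cB) W₂ g y‖) ^ 2 := by rw [mul_pow, mul_pow, Real.sq_sqrt hcB.le]; ring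
      _ ≤ ‖M g‖ ^ 2 := h1
  have h4 : ‖WL2.equiv ℂ (fun _ : PBond (F.P n) 0 => cB) W₂ g y‖ * (Real.sqrt cB * w y) ≤ ‖M g‖ :=
    (pow_le_pow_iff_left₀ (by positivity) (norm_nonneg _) two_ne_zero).mp h3
  exact (mul_le_mul_of_nonneg_right h2 (by positivity)).trans h4

/-- ★★★ **ENTRY DECAY OF `K⁻¹ = (Q_kGQ_k*)⁻¹` FROM A COARSE BOND SPIKE**: if `KK⁻¹ = 1` on the coarse carrier and the `w`-conjugate of `K` is accretive with constant `m > 0` (§1, from the three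
letters), then for all coarse bonds `y, y′` and `Z ∈ M₂(ℂ)`: `‖(toL2B⁻¹(K⁻¹(toL2B(δ_{y′}⊗Z))))(y)‖ ≤ √2·m⁻¹·(w y′∕w y)·‖Z‖` — with `w = e^{φ}`, `φ(y′) = 0`, this is `e^{−φ(y)}` decay.
[cite: Balaban1985BackgroundPropagators, (3.132) p.422] -/
theorem norm_symm_Kinv_single_le_of_conj_accretive [DecidableEq (PBond (F.P n) 0)] (Kop Kinv : WL2 ℂ (fun _ : PBond (F.P n) 0 => cB) W₂ →ₗ[ℂ] WL2 ℂ (fun _ : PBond (F.P n) 0 => cB) W₂)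
    (hKK : ∀ v, Kop (Kinv v) = v) (w : PBond (F.P n) 0 → ℝ) (hw : ∀ y, 0 < w y)
    (M : WL2 ℂ (fun _ : PBond (F.P n) 0 => cB) W₂ →ₗ[ℂ] WL2 ℂ (fun _ : PBond (F.P n) 0 => cB) W₂) (hMw : ∀ Z, M (toL2B F n cB Z) = toL2B F n cB (fun y => w y • Z y))
    {m : ℝ} (hm : 0 < m) (hacc : ∀ u, m * ‖M u‖ ^ 2 ≤ RCLike.re ⟪M u, M (Kop u)⟫_ℂ)
    (y y' : PBond (F.P n) 0) (Z : Matrix (Fin 2) (Fin 2) ℂ) :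
    ‖(toL2B F n cB).symm (Kinv (toL2B F n cB (Pi.single y' Z))) y‖ ≤ Real.sqrt 2 * m⁻¹ * (w y' / w y) * ‖Z‖ := by
  have hcB : 0 < cB := Fact.out
  have hs : 0 < Real.sqrt cB := Real.sqrt_pos.2 hcB
  have hwy : 0 < w y := hw y
  have hwy' : 0 < w y' := hw y'
  set v := toL2B F n cB (Pi.single y' Z) with hv
  have h1 := norm_symm_apply_le_of_weight w M hMw (Kinv v) y (hw y)
  have h2 := norm_weight_inv_le_of_conj_accretive Kop Kinv hKK M hm hacc v
  have h3 : ‖M v‖ = |w y'| * ‖v‖ := by rw [hv]; exact norm_weight_toL2B_single w M hMw y' Z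
  have h4 : ‖v‖ ≤ Real.sqrt cB * (Real.sqrt 2 * ‖Z‖) := by
    have e := norm_toL2B_single (cB := cB) (F := F) y' Z
    have h5 : ‖v‖ ^ 2 ≤ (Real.sqrt cB * (Real.sqrt 2 * ‖Z‖)) ^ 2 := by
      rw [hv, e, mul_pow, Real.sq_sqrt hcB.le]
      exact mul_le_mul_of_nonneg_left (pow_le_pow_left₀ (norm_nonneg _) (norm_frobEquiv_symm_le Z) 2) hcB.le
    exact (pow_le_pow_iff_left₀ (norm_nonneg _) (by positivity) two_ne_zero).mp h5
  rw [abs_of_pos (hw y')] at h3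
  calc ‖(toL2B F n cB).symm (Kinv v) y‖ ≤ ‖M (Kinv v)‖ / (Real.sqrt cB * w y) := h1
    _ ≤ (m⁻¹ * ‖M v‖) / (Real.sqrt cB * w y) := div_le_div_of_nonneg_right h2 (by positivity)
    _ = (m⁻¹ * (w y' * ‖v‖)) / (Real.sqrt cB * w y) := by rw [h3]
    _ ≤ (m⁻¹ * (w y' * (Real.sqrt cB * (Real.sqrt 2 * ‖Z‖)))) / (Real.sqrt cB * w y) := by
        gcongr
    _ = Real.sqrt 2 * m⁻¹ * (w y' / w y) * ‖Z‖ := by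
        rw [div_eq_iff (by positivity)]
        field_simp

end Member

end Summit.QuantumFields.YangMills.Theorems.Prop7KinvConjugateDecay

end
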